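import Literature.Barriers.CriticalPhenomena.RandomClusterFirstOrderProofs
import HarnessLib

/-!
# The wired coexistence bound ((7.79), (7.83)) from coexistence at ONE point (and from the window dichotomy)

Companion of `Literature.Barriers.CriticalPhenomena.RandomClusterFirstOrderProofs` (theorems
only). The *wired coexistence bound* — Grimmett 2006, proof of Thm. (7.33), eqs. (7.79) (at
`x = y = 0`, centred boxes) and (7.83): for `d ≥ 2` there are `Q`, `a > 0` such that for `q > Q`
some `p̃ ∈ (0, 1)` has `p̃ ≤ p_c(q)` and `1 - φ¹_{Λ_{n+1},p,q}(0 ↔ ∂Λ_{n+1}) ≤ e^{-aτ(q)}` for all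
`p ∈ [p̃, 1)` and all `n` — is the explicit HYPOTHESIS of the reduction
`RandomClusterFirstOrder_of_wiredCoexistenceBound` of §4 of that file. (It was briefly a named
fact of that file; being two displayed lines of the proof of Thm. (7.33) that carry the whole
Pirogov–Sinai analysis rather than a distinct published result, it was merged back into the
proof obligation of the barrier `RandomClusterFirstOrder` — D-0026 review, 2026-08-15 — and
survives only as a hypothesis spelled out in the statements below.) It is
stronger than the barrier `RandomClusterFirstOrder` — it carries the rate `e^{-aτ(q)}` and
`p_c(q) ∈ (0, 1)` — but it follows from the same output of the Pirogov–Sinai analysis as the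
dichotomy of §7 there, and in the exact form in which Grimmett's proof of Thm. (7.33) delivers
it: ONE point `p̃ = p̃(q) ∈ (0, 1)` (Thm. (7.42)(b), Lemma (7.65)) at which the WIRED box
measures percolate, `φ¹_{Λ_n,p̃,q}(0 ↔ ∂Λ_n) ≥ 1 - e^{-aτ(q)}` for every `n` ((7.79) at `p = p̃`,
`x = y = 0`, available because `b_w(p̃) = 0`), AND the FREE box measures decay ((7.81)–(7.82)
at `p = p̃`, because `b_f(p̃) = 0`). Uniformity in `p ∈ [p̃, 1)` is automatic (comparison
inequality (3.22): `p ↦ φ¹_{Λ_n,p,q}(0 ↔ ∂Λ_n)` is non-decreasing), and `p̃ ≤ p_c(q)` ((7.83))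
is free decay plus `thetaWired_eq_zero_of_lt_of_freeDecay`.

## Contents (everything proved; no definitions, no named facts)

* `le_rcCriticalProb_of_freeDecay`: free decay at `p ≤ 1` gives `p ≤ p_c(q)` ((7.82)–(7.83)).
* `mem_wiredPercolationSet_of_le`: uniform wired percolation at `p` persists on `[p, 1]` ((3.22)).
* `wiredCoexistenceBound_of_coexistence`: coexistence at one point `p̃ ∈ (0, 1)` ⇒ the wired
  coexistence bound; `RandomClusterFirstOrder_of_coexistence`: ⇒ the barrier.
* `le_thetaWiredBox_rcCriticalProb_of_forall_gt`: right-continuity at `p_c(q)` box by box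
  (continuity of finite-volume probabilities in `p`, proof of Thm. (4.58)).
* `rcCriticalProb_mem_wiredPercolationSet_of_dichotomy`, `wiredCoexistenceBound_of_dichotomy`:
  the window dichotomy of §7 (rate form, window inside `(0, 1)`) ⇒ uniform wired percolation AT
  `p_c(q)` ⇒ the wired coexistence bound with `p̃ := p_c(q)`.

What remains for `RandomClusterFirstOrder_holds` along this line is exactly the coexistence
hypothesis `h` of `RandomClusterFirstOrder_of_coexistence` — the content of Thm. (7.42)(b) with
(7.79) and (7.81), i.e. the Pirogov–Sinai analysis of Grimmett 2006 §§7.3–7.5 ('Theorem' (7.27),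
Lemmas (7.51), (7.65), the contour geometry Thms. (7.3), (7.5)); it is NOT proved in the tree,
and (D-0026) it is to be proved with inline lemmas, not vendored as a further named fact.

## References

* G. Grimmett, *The Random-Cluster Model*, Springer 2006: Thm. (3.21) (3.22); proof of
  Thm. (4.58); (5.2)–(5.4), Prop. (5.11); §7.5: Thm. (7.33), Thm. (7.42) with (7.44)–(7.46),
  (7.62), Lemma (7.65), proof of Thm. (7.33) eqs. (7.78)–(7.83). [Grimmett2006]
* L. Laanait, A. Messager, S. Miracle-Solé, J. Ruiz, S. Shlosman, Comm. Math. Phys. 140 (1991)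
  81–91 (Grimmett's [224]).
-/

noncomputable section

namespace Literature.Barriers.CriticalPhenomena

open MeasureTheory Filter _root_.Topology Literature.Probability.LatticeModels
  Literature.Probability.Percolation

variable {d : ℕ}

/-- **Free decay at `p` places `p` at or below the critical point**: if the free box measures
decay at `p ≤ 1` then `p ≤ p_c(q)` (`q ≥ 1`, `d ≥ 1`) — Grimmett's "(7.82) … Hence `p ≤ p_c(q)`",
with (5.4) `p_c⁰ = p_c¹` replaced by its finite-volume core as in
`thetaWired_eq_zero_of_lt_of_freeDecay`: every `p'' ∈ [0, p)` has `θ¹(p'', q) = 0`, hence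
`p'' ≤ p_c(q)`, and `p ≤ p_c(q)` by density.
[cite: Grimmett2006, proof of Thm. (7.33), eqs. (7.82)–(7.83)] -/
theorem le_rcCriticalProb_of_freeDecay (hd : 0 < d) {q : ℝ} (hq : 1 ≤ q) {p : ℝ} (hp1 : p ≤ 1)
    (hfd : p ∈ freeDecaySet d q) : p ≤ rcCriticalProb d q := by
  refine le_of_forall_lt_imp_le_of_dense fun p'' hp'' => ?_
  rcases lt_or_ge p'' 0 with hneg | hnn
  · exact hneg.le.trans (rcCriticalProb_mem_Icc d q).1
  · exact le_rcCriticalProb_of_thetaWired_eq_zero ⟨hnn, hp''.le.trans hp1⟩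
      (thetaWired_eq_zero_of_lt_of_freeDecay hd hq hp1 hfd hnn hp'')

/-- **Uniform wired percolation at `p` persists on `[p, 1]`**: if `c ≤ φ¹_{Λ_n,p,q}(0 ↔ ∂Λ_n)`
for every `n` at some `p ∈ [0, 1]`, then the same holds at every `p' ∈ [p, 1]` (`q ≥ 1`;
comparison inequality (3.22) for the increasing event `{0 ↔ ∂Λ_n}`) — so (7.79) at the single
parameter `p = p̃` already yields its consequence for all `p ≥ p̃`.
[cite: Grimmett2006, Thm. (3.21), eq. (3.22); proof of Thm. (7.33), eq. (7.79)] -/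
theorem mem_wiredPercolationSet_of_le {q c p p' : ℝ} (hq : 1 ≤ q) (hp : 0 ≤ p) (hpp' : p ≤ p')
    (hp'1 : p' ≤ 1) (h : p ∈ wiredPercolationSet d q c) : p' ∈ wiredPercolationSet d q c :=
  fun n => (h n).trans
    (thetaWiredBox_mono_left d ⟨hp, hpp'.trans hp'1⟩ ⟨hp.trans hpp', hp'1⟩ hpp' hq n)

/-- **The wired coexistence bound from coexistence at one point** (the architecture of
Grimmett's proof of Thm. (7.33)(b) from Thm. (7.42)(b) and Lemma (7.65)). Suppose that for every
`d ≥ 2` there are `Q` and `a > 0` such that for every real `q > Q` some `p̃ ∈ (0, 1)` is a point of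
COEXISTENCE: the wired box measures percolate at `p̃`, `φ¹_{Λ_n,p̃,q}(0 ↔ ∂Λ_n) ≥ 1 - e^{-aτ(q)}`
for every `n` ((7.79) at `x = y = 0`, `p = p̃`, from `b_w(p̃) = 0`), and the free box measures
decay at `p̃` ((7.81)–(7.82) at `p = p̃`, from `b_f(p̃) = 0`). Then the wired coexistence bound
— (7.83) `p̃ ≤ p_c(q)` together with (7.79) uniformly on `[p̃, 1)`, the hypothesis of
`RandomClusterFirstOrder_of_wiredCoexistenceBound` — holds with the same `a` and `p̃` and with
`Q` enlarged to `max(Q, 1)`: `p̃ ≤ p_c(q)` by `le_rcCriticalProb_of_freeDecay`, and the bound on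
`[p̃, 1)` by `mem_wiredPercolationSet_of_le`. The hypothesis is what the Pirogov–Sinai analysis
supplies; it is not proved in the tree.
[cite: Grimmett2006, Thm. (7.42)(b), Lemma (7.65), and proof of Thm. (7.33), eqs. (7.79)–(7.83)] -/
theorem wiredCoexistenceBound_of_coexistence
    (h : ∀ d : ℕ, 2 ≤ d → ∃ Q a : ℝ, 0 < a ∧ ∀ q : ℝ, Q < q →
      ∃ pt : ℝ, pt ∈ Set.Ioo (0 : ℝ) 1 ∧
        pt ∈ wiredPercolationSet d q (1 - Real.exp (-(a * rcTau d q))) ∧ pt ∈ freeDecaySet d q) :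
    ∀ d : ℕ, 2 ≤ d → ∃ Q a : ℝ, 0 < a ∧ ∀ q : ℝ, Q < q →
      ∃ pt : ℝ, pt ∈ Set.Ioo (0 : ℝ) 1 ∧ pt ≤ rcCriticalProb d q ∧
        ∀ p ∈ Set.Ico pt 1, ∀ n : ℕ,
          1 - thetaWiredBox d p q (n + 1) ≤ Real.exp (-(a * rcTau d q)) := by
  intro d hd
  obtain ⟨Q, a, ha, hQ⟩ := h d hd
  refine ⟨max Q 1, a, ha, fun q hq => ?_⟩
  obtain ⟨hQq, hq1⟩ := max_lt_iff.1 hq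
  obtain ⟨pt, hpt, hW, hF⟩ := hQ q hQq
  have hd0 : 0 < d := lt_of_lt_of_le two_pos hd
  refine ⟨pt, hpt, le_rcCriticalProb_of_freeDecay hd0 hq1.le hpt.2.le hF, fun p hp n => ?_⟩
  have hn := mem_wiredPercolationSet_of_le hq1.le hpt.1.le hp.1 hp.2.le hW (n + 1)
  linarith

/-- **The barrier from coexistence at one point**: under the coexistence hypothesis of
`wiredCoexistenceBound_of_coexistence` (Thm. (7.42)(b) with (7.79) at `p = p̃` and (7.81)–(7.82)
at `p = p̃`), `RandomClusterFirstOrder` holds — Grimmett's proof of Thm. (7.33)(b) from its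
Pirogov–Sinai input, assembled: `wiredCoexistenceBound_of_coexistence`, then
`RandomClusterFirstOrder_of_wiredCoexistenceBound` (for `q > max(Q, 1, e^{40d})`,
`θ¹(p_c(q), q) ≥ 1 - e^{-aτ(q)} > 0`). This is the entry point for a proof of
`RandomClusterFirstOrder_holds` along Grimmett's line; the hypothesis is NOT proved in the tree.
[cite: Grimmett2006, Thm. (7.33)(b), Thm. (7.42)(b), Lemma (7.65), and proof of Thm. (7.33), eqs. (7.79)–(7.83)] -/
theorem RandomClusterFirstOrder_of_coexistence
    (h : ∀ d : ℕ, 2 ≤ d → ∃ Q a : ℝ, 0 < a ∧ ∀ q : ℝ, Q < q →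
      ∃ pt : ℝ, pt ∈ Set.Ioo (0 : ℝ) 1 ∧
        pt ∈ wiredPercolationSet d q (1 - Real.exp (-(a * rcTau d q))) ∧ pt ∈ freeDecaySet d q) :
    RandomClusterFirstOrder :=
  RandomClusterFirstOrder_of_wiredCoexistenceBound (wiredCoexistenceBound_of_coexistence h)

/-- **Right-continuity at `p_c(q)`, box by box**: if `c ≤ φ¹_{Λ_n,p,q}(0 ↔ ∂Λ_n)` for every
`p ∈ (p_c(q), 1]` (`p_c(q) < 1`, `q > 0`), then `c ≤ φ¹_{Λ_n,p_c(q),q}(0 ↔ ∂Λ_n)`, because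
`p ↦ φ¹_{Λ_n,p,q}(0 ↔ ∂Λ_n)` is continuous on `[0, 1]` (a quotient of polynomials in `p`).
[cite: Grimmett2006, proof of Thm. (4.58) (continuity of finite-volume quantities in p)] -/
theorem le_thetaWiredBox_rcCriticalProb_of_forall_gt {q : ℝ} (hq : 0 < q) {c : ℝ}
    (hpc1 : rcCriticalProb d q < 1) (n : ℕ)
    (h : ∀ p : ℝ, rcCriticalProb d q < p → p ≤ 1 → c ≤ thetaWiredBox d p q n) :
    c ≤ thetaWiredBox d (rcCriticalProb d q) q n := by
  have hpcI := rcCriticalProb_mem_Icc d q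
  have hcont : ContinuousWithinAt (fun p : ℝ => thetaWiredBox d p q n)
      (Set.Ioc (rcCriticalProb d q) 1) (rcCriticalProb d q) := by
    have h0 := continuousWithinAt_rcMeasure_real (boxGraph d n) hq (boxBoundary d n)
      (originToBoundary d n) hpcI
    exact h0.mono fun p hp => ⟨hpcI.1.trans hp.1.le, hp.2⟩
  haveI : (𝓝[Set.Ioc (rcCriticalProb d q) 1] rcCriticalProb d q).NeBot := by
    rw [nhdsWithin_Ioc_eq_nhdsGT hpc1]
    infer_instance
  refine ge_of_tendsto hcont ?_
  filter_upwards [self_mem_nhdsWithin] with p hp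
  exact h p hp.1 hp.2

/-- **Uniform wired percolation AT `p_c(q)` from the window dichotomy** (`q ≥ 1`, `d ≥ 1`): under
hypotheses (i)–(iii) of `le_thetaWired_rcCriticalProb_of_dichotomy` on a window
`0 ≤ p_bot ≤ p_top < 1` with constant `c > 0`, every box satisfies
`c ≤ φ¹_{Λ_n,p_c(q),q}(0 ↔ ∂Λ_n)`. As in §7: `p_bot ≤ p_c(q) ≤ p_top`; strictly above `p_c(q)`
the bound holds box by box (beyond `p_top` by (ii) and monotonicity in `p`, on the window by the
dichotomy, the free alternative being impossible above `p_c(q)`); at `p_c(q)` itself by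
`le_thetaWiredBox_rcCriticalProb_of_forall_gt`.
[cite: Grimmett2006, proof of Thm. (7.33), eqs. (7.79)–(7.83), and Thm. (7.42), eq. (7.62)] -/
theorem rcCriticalProb_mem_wiredPercolationSet_of_dichotomy (hd : 0 < d) {q : ℝ} (hq : 1 ≤ q)
    {pbot ptop c : ℝ} (hc : 0 < c) (hbot : 0 ≤ pbot) (hbt : pbot ≤ ptop) (htop : ptop < 1)
    (hdich : ∀ p ∈ Set.Icc pbot ptop, p ∈ wiredPercolationSet d q c ∨ p ∈ freeDecaySet d q)
    (hWP : ptop ∈ wiredPercolationSet d q c) (hFD : pbot ∈ freeDecaySet d q) :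
    rcCriticalProb d q ∈ wiredPercolationSet d q c := by
  have hq0 : 0 < q := one_pos.trans_le hq
  have htopI : ptop ∈ Set.Icc (0 : ℝ) 1 := ⟨hbot.trans hbt, htop.le⟩
  -- `p_c ≤ p_top < 1` from (ii), `p_bot ≤ p_c` from (iii)
  have hpc_top : rcCriticalProb d q ≤ ptop :=
    rcCriticalProb_le_of_thetaWired_pos hq htopI
      (hc.trans_le (le_thetaWired_of_forall fun n => hWP (n + 1)))
  have hpc1 : rcCriticalProb d q < 1 := hpc_top.trans_lt htop
  have hbot_pc : pbot ≤ rcCriticalProb d q :=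
    le_rcCriticalProb_of_freeDecay hd hq (hbt.trans htop.le) hFD
  intro n
  refine le_thetaWiredBox_rcCriticalProb_of_forall_gt hq0 hpc1 n fun p hpcp hp1 => ?_
  rcases le_or_gt ptop p with htp | hpt
  · -- beyond `p_top`: (ii) and monotonicity in `p`
    exact mem_wiredPercolationSet_of_le hq htopI.1 htp hp1 hWP n
  · rcases hdich p ⟨hbot_pc.trans hpcp.le, hpt.le⟩ with hwp | hfd
    · exact hwp n
    · -- free decay strictly above `p_c` is impossible
      exfalso
      obtain ⟨p'', hpcp'', hp''p⟩ := exists_between hpcp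
      have hnn : 0 ≤ p'' := (rcCriticalProb_mem_Icc d q).1.trans hpcp''.le
      have h0 := thetaWired_eq_zero_of_lt_of_freeDecay hd hq hp1 hfd hnn hp''p
      exact (thetaWired_pos_of_rcCriticalProb_lt (d := d) (q := q)
        ⟨hnn, hp''p.le.trans hp1⟩ hpcp'').ne' h0

/-- **The wired coexistence bound from the window dichotomy** (rate form). Suppose that for
every `d ≥ 2` there are `Q` and `a > 0` such that for every real `q > Q` some window
`0 < p_bot ≤ p_top < 1` satisfies (i)–(iii) of `le_thetaWired_rcCriticalProb_of_dichotomy` with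
percolation constant `c = 1 - e^{-aτ(q)}` — at every `p` of the window the wired box measures
percolate with probability `≥ 1 - e^{-aτ(q)}` or the free box measures decay ((7.62)
`min(b_w, b_f) = 0` with (7.79), (7.81)), they percolate at `p_top` and decay at `p_bot`. Then
the wired coexistence bound (the hypothesis of `RandomClusterFirstOrder_of_wiredCoexistenceBound`:
(7.83) with (7.79) uniformly on `[p̃, 1)`) holds with `p̃ := p_c(q)` (for `q > max(Q, 1, e^{40d})`,
where `τ(q) > 0`): `0 < p_bot ≤ p_c(q) ≤ p_top < 1`, and the bound on `[p_c(q), 1)` is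
`rcCriticalProb_mem_wiredPercolationSet_of_dichotomy` with `mem_wiredPercolationSet_of_le`.
[cite: Grimmett2006, proof of Thm. (7.33), eqs. (7.79)–(7.83), and Thm. (7.42), eq. (7.62)] -/
theorem wiredCoexistenceBound_of_dichotomy
    (h : ∀ d : ℕ, 2 ≤ d → ∃ Q a : ℝ, 0 < a ∧ ∀ q : ℝ, Q < q →
      ∃ pbot ptop : ℝ, 0 < pbot ∧ pbot ≤ ptop ∧ ptop < 1 ∧
        (∀ p ∈ Set.Icc pbot ptop,
          p ∈ wiredPercolationSet d q (1 - Real.exp (-(a * rcTau d q))) ∨ p ∈ freeDecaySet d q) ∧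
        ptop ∈ wiredPercolationSet d q (1 - Real.exp (-(a * rcTau d q))) ∧
        pbot ∈ freeDecaySet d q) :
    ∀ d : ℕ, 2 ≤ d → ∃ Q a : ℝ, 0 < a ∧ ∀ q : ℝ, Q < q →
      ∃ pt : ℝ, pt ∈ Set.Ioo (0 : ℝ) 1 ∧ pt ≤ rcCriticalProb d q ∧
        ∀ p ∈ Set.Ico pt 1, ∀ n : ℕ,
          1 - thetaWiredBox d p q (n + 1) ≤ Real.exp (-(a * rcTau d q)) := by
  intro d hd
  obtain ⟨Q, a, ha, hQ⟩ := h d hd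
  refine ⟨max (max Q 1) (Real.exp (40 * d)), a, ha, fun q hq => ?_⟩
  obtain ⟨hq', hexp⟩ := max_lt_iff.1 hq
  obtain ⟨hQq, hq1⟩ := max_lt_iff.1 hq'
  obtain ⟨pbot, ptop, hbot, hbt, htop, hdich, hWP, hFD⟩ := hQ q hQq
  have hd0 : 0 < d := lt_of_lt_of_le two_pos hd
  have hc : 0 < 1 - Real.exp (-(a * rcTau d q)) :=
    sub_pos.2 (Real.exp_lt_one_iff.2 (neg_neg_of_pos (mul_pos ha (rcTau_pos hd0 hexp))))
  have hpcW := rcCriticalProb_mem_wiredPercolationSet_of_dichotomy hd0 hq1.le hc hbot.le hbt htop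
    hdich hWP hFD
  have hpcI := rcCriticalProb_mem_Icc d q
  have hbot_pc : pbot ≤ rcCriticalProb d q :=
    le_rcCriticalProb_of_freeDecay hd0 hq1.le (hbt.trans htop.le) hFD
  have hpc_top : rcCriticalProb d q ≤ ptop :=
    rcCriticalProb_le_of_thetaWired_pos hq1.le ⟨hbot.le.trans hbt, htop.le⟩
      (hc.trans_le (le_thetaWired_of_forall fun n => hWP (n + 1)))
  refine ⟨rcCriticalProb d q, ⟨hbot.trans_le hbot_pc, hpc_top.trans_lt htop⟩, le_rfl,
    fun p hp n => ?_⟩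
  have hn := mem_wiredPercolationSet_of_le hq1.le hpcI.1 hp.1 hp.2.le hpcW (n + 1)
  linarith

end Literature.Barriers.CriticalPhenomena

end
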